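import Summits.BirchSwinnertonDyer.BirchSwinnertonDyer.Theses.QuadraticBranchSignedControl
import Summits.BirchSwinnertonDyer.BirchSwinnertonDyer.Theorems.QuadraticBranchSignedControlEtaDescentFrame
import HarnessLib

/-!
# Route `QuadraticBranchSignedControl` (rung K8, cell `bsd-potss`): item stmt-BirchSwinnertonDyer-19607
# `EtaDescentFrameNonsurj` — PROVED (restriction of the full frame `EtaDescentFrame`, item 19611)

WHAT. `EtaDescentFrameNonsurj` is the ∀-form prime-to-`p` descent frame (`Φ : Sel⁺(V'/F_∞) ≃+
Sel⁺(V/ℚ_∞) × Sel⁺(V/K₀ℚ_∞)^η`, Γ-equivariant, every admissible quadratic model) RESTRICTED to the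
non-onto-tower rows `¬ ∀ m, ρ_{V,p^m} onto` — exactly the hypothesis the glue 19609
`PlusMainConjectureNonsurjBranchOfEta` (this seat, p444282) consumes together with the crux 19606
`PlusEtaMainConjectureNonsurj`. The full frame `EtaDescentFrame` (no row condition) is this seat's
theorem `etaDescentFrame_proof` (file `…EtaDescentFrame.lean`); the restriction forgets the row
condition (the planner's certified one-line term, HOME `plan/edit-g13/K8eta/K8EtaSketch.lean`).

HONEST FRAMING (cell `bsd-potss`, run/shared/lean/pub/bsd-potss/; FULL-BSD rank ≤ 1 programme):
closes the SUPPORT item 19607 only, UNCONDITIONALLY; the crux 19606 (Kobayashi's even main conjecture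
on the `η`-component on the non-onto rows — open problem class-wide) is NOT touched; `BSD(W, p)` is
claimed for no pair. Seat `bsd-potss-k8eta-c2` (prover), g0; `--workitem stmt-BirchSwinnertonDyer-19607`.

References: [Kobayashi2003] Def. 1.1 (p. 2), Def. 2.1 (p. 5), §4 p. 8; [GreenbergLNM1716] §3.
-/

set_option autoImplicit false
set_option linter.dupNamespace false

namespace Summit.BirchSwinnertonDyer.BirchSwinnertonDyer.Theorems

/-- **Item stmt-BirchSwinnertonDyer-19607 `EtaDescentFrameNonsurj` — PROVED** (the full ∀-form
descent frame `etaDescentFrame_proof`, item 19611, restricted to the non-onto-tower rows by dropping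
the row hypothesis). UNCONDITIONAL; support item only. [cite: Kobayashi2003, Def. 1.1 (p. 2), Def. 2.1 (p. 5), §4 p. 8]
[cite: GreenbergLNM1716, §3] -/
theorem etaDescentFrameNonsurj_proof :
    Summit.BirchSwinnertonDyer.BirchSwinnertonDyer.Theses.QuadraticBranchSignedControl.EtaDescentFrameNonsurj := by
  unfold Theses.QuadraticBranchSignedControl.EtaDescentFrameNonsurj
  have h := etaDescentFrame_proof
  unfold Theses.QuadraticBranchSignedControl.EtaDescentFrame at h
  intro p _ hp5 K₀ _ _ _ _ ηq hηK hη1 V _ _ hgood hap _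
  exact h p hp5 K₀ ηq hηK hη1 V hgood hap

end Summit.BirchSwinnertonDyer.BirchSwinnertonDyer.Theorems
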